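import Literature.AlgebraicGeometry.Markman2025.SecantQuotientPolarization
import Literature.AlgebraicGeometry.HodgeTheory.AbelianVarietyTorsionPointsHomology
import Literature.AlgebraicGeometry.HodgeTheory.AmpleDivisorChernClassNeZero
import HarnessLib

/-!
# The secant-quotient envelope is INHABITED over every principally polarised Jacobian threefold:
# two independent cyclic subgroups of `J[n](ℂ) ≅ (ℤ/n)^{2g}` and the sixfold `(J × Ĵ)/Ḡ`

Family `hodge`, layer `Literature/AlgebraicGeometry/Markman2025` (continuation of `SecantQuotientCarrier`,
`SecantQuotientPolarization`; typer seat `hodge-lit-avcarriers`). The anchor envelopes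
`IsSecantQuotientSixfold d Y` / `IsSecantQuotientAnchorWith d X θ_X` of the ring-2 cells quantify over a
curve `C`, a Jacobian `𝒥` with `dim J = 3`, a Riemann theta divisor `Θ` which is a principal polarisation
divisor, and two CYCLIC subgroups `G₁, G₂ ≤ J[d+1](ℂ)` of order `d + 1` with `G₁ ∩ G₂ = 0`. This file PROVES
that the last datum always exists and hence that the envelopes are inhabited over every such `(C, 𝒥, Θ)`:

* §1 (`Motives.AbelianVariety`, general): `exists_isCyclic_pair_le_torsionPoints` — **for a complex abelian
  variety `A` of dimension `g ≥ 1` and `n ≥ 1` there are cyclic subgroups `G₁, G₂ ≤ A[n](ℂ)` of order `n`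
  with `G₁ ⊓ G₂ = ⊥`**: the first two coordinate lines of `A[n](ℂ) ≅ (ℤ/nℤ)^{2g}` (Mumford §6 App. 3,
  Proposition p. 64; Lange 2023 Prop. 1.1.14; the tree`s `HodgeTheory.AbelianVariety.nonempty_torsionPoints_mulEquiv_pi_zmod`);
* §2 (`Markman2025`): `exists_isSecantQuotientSixfold` — **for every smooth projective complex curve `C`,
  Jacobian `𝒥` with `dim J = 3`, Riemann theta divisor `Θ` which is a principal polarisation divisor, and
  every `d`, the secant quotient `Y = (J × Ĵ)/Ḡ` exists: `∃ Y, IsSecantQuotientSixfold d Y`**, and WITH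
  CLASS `∃ Y θ_Y, IsSecantQuotientAnchorWith d Y.X θ_Y` (`exists_isSecantQuotientAnchorWith`, the polarisation
  class `θ₀ ∈ ℚˣ·[Θ]` existing by `HodgeTheory/AmpleDivisorChernClassNeZero`); modulo the ONE named fact of
  `Motives/JacobianThetaDivisor` (Riemann: `W̃_{g-1}` is a principal polarisation divisor) this needs only a
  smooth projective complex curve whose Jacobian has dimension `3`
  (`exists_isSecantQuotientSixfold_of_riemann`).

HONEST SCOPE. Not constructed here: a genus-`3` curve (the envelopes stay quantified over `(C, 𝒥)`); the
genericity conditions of the preprint (`TranslatesInGeneralPosition`, "generic non-hyperelliptic `C`",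
`d` even `≥ 4`) are not part of the envelopes and are NOT established for the witnesses. Everything is
proved; no definition, no named fact.

## References

* [MumfordAV1970] D. Mumford, *Abelian Varieties* (1970), §6 Application 3, Proposition (p. 64):
  `X_n ≅ (ℤ/nℤ)^{2g}` for `n` prime to the characteristic.
* [Lange2023AbelianVarietiesComplex] H. Lange, *Abelian Varieties over the Complex Numbers* (2023), §1.1.2
  Prop. 1.1.14 (`X[n] ≅ (ℤ/nℤ)^{2g}`), §2.1.1.
* [Markman2025SecantWeil] E. Markman, arXiv:2502.03415v2 (2025), §1.5 (p. 7) (the groups `G₁, G₂ ⊂ J[d+1]`,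
  cyclic of order `d + 1`, and `Y = (X × X̂)/Ḡ`). UNREFEREED PREPRINT — cited for the shape only.
* Tree: `HodgeTheory/AbelianVarietyTorsionPointsHomology` (`A[n](ℂ) ≃ (ℤ/n)^{2g}`), `Markman2025/SecantQuotientCarrier`,
  `Markman2025/SecantQuotientPolarization`, `HodgeTheory/AmpleDivisorChernClassNeZero`, `Motives/JacobianThetaDivisor`.
-/

noncomputable section

open CategoryTheory

namespace Literature.AlgebraicGeometry.Motives

namespace AbelianVariety

open Literature.AlgebraicGeometry.HodgeTheory

/-! ## §1 Two independent cyclic subgroups of order `n` in `A[n](ℂ) ≅ (ℤ/nℤ)^{2g}` -/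

variable (A : AbelianVariety ℂ)

/-- The order of the image of the `i`-th coordinate vector `e_i ∈ (ℤ/nℤ)^{2g}` under a group isomorphism
`(ℤ/nℤ)^{2g} ≅ A[n](ℂ)` (read in `A(ℂ)`) is `n`. [cite: Lange2023AbelianVarietiesComplex, §1.1.2 Prop. 1.1.14] -/
private theorem orderOf_coe_symm_single {n : ℕ} [NeZero n]
    (e : A.torsionPoints ℂ n ≃* Multiplicative (Fin (2 * A.dim) → ZMod n)) (i : Fin (2 * A.dim)) :
    orderOf ((e.symm (Multiplicative.ofAdd (Pi.single i (1 : ZMod n))) : A.Points ℂ)) = n := by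
  rw [Subgroup.orderOf_coe, MulEquiv.orderOf_eq, orderOf_ofAdd_eq_addOrderOf]
  have hinj : Function.Injective (AddMonoidHom.single (fun _ : Fin (2 * A.dim) => ZMod n) i) :=
    fun a b h => Pi.single_injective (M := fun _ : Fin (2 * A.dim) => ZMod n) i
      (by simpa only [AddMonoidHom.single_apply] using h)
  rw [show (Pi.single i (1 : ZMod n) : Fin (2 * A.dim) → ZMod n) =
      AddMonoidHom.single (fun _ : Fin (2 * A.dim) => ZMod n) i 1 from rfl,
    addOrderOf_injective (AddMonoidHom.single (fun _ : Fin (2 * A.dim) => ZMod n) i) hinj,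
    ZMod.addOrderOf_one]

/-- Powers of the image of `e_i` are images of multiples of `e_i`: `(e⁻¹ e_i)^k = e⁻¹(k • e_i)`, read in
`A(ℂ)`. [cite: Lange2023AbelianVarietiesComplex, §1.1.2 Prop. 1.1.14] -/
private theorem coe_symm_single_zpow {n : ℕ} (e : A.torsionPoints ℂ n ≃* Multiplicative (Fin (2 * A.dim) → ZMod n))
    (i : Fin (2 * A.dim)) (k : ℤ) :
    ((e.symm (Multiplicative.ofAdd (Pi.single i (1 : ZMod n))) : A.Points ℂ)) ^ k =
      (e.symm (Multiplicative.ofAdd (k • Pi.single i (1 : ZMod n))) : A.Points ℂ) := by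
  rw [← Subgroup.coe_zpow, ← map_zpow, ← ofAdd_zsmul]

/-- **Two independent cyclic subgroups of order `n` in the `n`-torsion.** For a complex abelian variety `A`
of dimension `g ≥ 1` and `n ≥ 1` there are cyclic subgroups `G₁, G₂ ≤ A[n](ℂ)` of order `n` with
`G₁ ⊓ G₂ = ⊥` — the coordinate lines `⟨e₁⟩, ⟨e₂⟩` of `A[n](ℂ) ≅ (ℤ/nℤ)^{2g}` (Mumford §6 App. 3; Lange
Prop. 1.1.14; `2g ≥ 2`). These are the groups `G₁, G₂ ⊂ X[d+1]` of Markman's secant construction (§1.5).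
[cite: MumfordAV1970, §6 Application 3 (Proposition p. 64)] [cite: Lange2023AbelianVarietiesComplex, §1.1.2 Prop. 1.1.14] -/
theorem exists_isCyclic_pair_le_torsionPoints (hA : 1 ≤ A.dim) {n : ℕ} (hn : n ≠ 0) :
    ∃ G₁ G₂ : Subgroup (A.Points ℂ), G₁ ≤ A.torsionPoints ℂ n ∧ G₂ ≤ A.torsionPoints ℂ n ∧
      IsCyclic G₁ ∧ Nat.card G₁ = n ∧ IsCyclic G₂ ∧ Nat.card G₂ = n ∧ G₁ ⊓ G₂ = ⊥ := by
  haveI : NeZero n := ⟨hn⟩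
  obtain ⟨e⟩ := HodgeTheory.AbelianVariety.nonempty_torsionPoints_mulEquiv_pi_zmod A n hn
  let i₁ : Fin (2 * A.dim) := ⟨0, by omega⟩
  let i₂ : Fin (2 * A.dim) := ⟨1, by omega⟩
  have hi : i₂ ≠ i₁ := fun h => by simpa [i₁, i₂] using congrArg Fin.val h
  set x₁ : A.Points ℂ := (e.symm (Multiplicative.ofAdd (Pi.single i₁ (1 : ZMod n))) : A.Points ℂ) with hx₁
  set x₂ : A.Points ℂ := (e.symm (Multiplicative.ofAdd (Pi.single i₂ (1 : ZMod n))) : A.Points ℂ) with hx₂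
  refine ⟨Subgroup.zpowers x₁, Subgroup.zpowers x₂, ?_, ?_, inferInstance, ?_, inferInstance, ?_, ?_⟩
  · exact (Subgroup.zpowers_le (G := A.Points ℂ)).2 (e.symm _).2
  · exact (Subgroup.zpowers_le (G := A.Points ℂ)).2 (e.symm _).2
  · rw [Nat.card_zpowers, hx₁, A.orderOf_coe_symm_single e i₁]
  · rw [Nat.card_zpowers, hx₂, A.orderOf_coe_symm_single e i₂]
  · -- a common element `x₁^a = x₂^b` is `e⁻¹(a e₁) = e⁻¹(b e₂)`, so `a e₁ = b e₂`, whose `i₁`-coordinate gives `a = 0`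
    rw [eq_bot_iff]
    intro y hy
    rw [Subgroup.mem_inf, Subgroup.mem_zpowers_iff, Subgroup.mem_zpowers_iff] at hy
    obtain ⟨⟨a, ha⟩, ⟨b, hb⟩⟩ := hy
    rw [Subgroup.mem_bot, ← ha]
    rw [hx₁, A.coe_symm_single_zpow e i₁ a] at ha
    rw [hx₂, A.coe_symm_single_zpow e i₂ b] at hb
    have hab := ha.trans hb.symm
    have hab' : (a • Pi.single i₁ (1 : ZMod n) : Fin (2 * A.dim) → ZMod n) = b • Pi.single i₂ (1 : ZMod n) := by
      exact Multiplicative.ofAdd.injective (e.symm.injective (Subtype.ext hab))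
    have ha0 : (a : ZMod n) = 0 := by
      have h := congrFun hab' i₁
      simp only [Pi.smul_apply, Pi.single_eq_same, Pi.single_eq_of_ne hi.symm, mul_one,
        smul_zero, zsmul_eq_mul] at h
      exact h
    rw [hx₁, A.coe_symm_single_zpow e i₁ a,
      show (a • Pi.single i₁ (1 : ZMod n) : Fin (2 * A.dim) → ZMod n) = 0 by
        rw [← Pi.single_zsmul, zsmul_eq_mul, mul_one, ha0, Pi.single_zero],
      ofAdd_zero, map_one, Subgroup.coe_one]

/-- The same for the torsion of level `d + 1` (the shape used by the secant-quotient envelopes).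
[cite: MumfordAV1970, §6 Application 3 (Proposition p. 64)] -/
theorem exists_isCyclic_pair_le_torsionPoints_succ (hA : 1 ≤ A.dim) (d : ℕ) :
    ∃ G₁ G₂ : Subgroup (A.Points ℂ), G₁ ≤ A.torsionPoints ℂ (d + 1 : ℕ) ∧ G₂ ≤ A.torsionPoints ℂ (d + 1 : ℕ) ∧
      IsCyclic G₁ ∧ Nat.card G₁ = d + 1 ∧ IsCyclic G₂ ∧ Nat.card G₂ = d + 1 ∧ G₁ ⊓ G₂ = ⊥ :=
  A.exists_isCyclic_pair_le_torsionPoints hA (Nat.succ_ne_zero d)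

end AbelianVariety

end Literature.AlgebraicGeometry.Motives

/-! ## §2 The envelopes are inhabited over every principally polarised Jacobian threefold -/

namespace Literature.AlgebraicGeometry.Markman2025

open Literature.AlgebraicGeometry.Motives Literature.AlgebraicGeometry.HodgeTheory
open Literature.AlgebraicTopology.SingularHomology

/-- **The secant quotient `Y = (J × Ĵ)/Ḡ` exists over every `(C, 𝒥, Θ)`**: for a smooth projective complex curve
`C`, a Jacobian `𝒥` with `dim J = 3`, a Riemann theta divisor `Θ` which is a principal polarisation divisor, and
every level `d`, there is an abelian variety `Y` with `IsSecantQuotientSixfold d Y` — take `G₁, G₂ = ⟨e₁⟩, ⟨e₂⟩`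
in `J[d+1](ℂ) ≅ (ℤ/(d+1))⁶` and `Y := secantQuotient …`. [cite: Markman2025SecantWeil, §1.5 (p. 7)]
[cite: MumfordAV1970, §6 Application 3 (Proposition p. 64)] -/
theorem exists_isSecantQuotientSixfold {C : SchemeOver ℂ} (hC : IsSmoothProjective 1 C) (𝒥 : Jacobian C)
    (h3 : 𝒥.J.dim = 3) {Θ : CartierDivisor 𝒥.J.X.left} (hR : 𝒥.IsRiemannThetaDivisor Θ)
    (hP : 𝒥.J.IsPrincipalPolarizationDivisor Θ) (d : ℕ) :
    ∃ Y : AbelianVariety ℂ, IsSecantQuotientSixfold d Y := by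
  obtain ⟨G₁, G₂, h₁, h₂, hc₁, hn₁, hc₂, hn₂, hbot⟩ :=
    𝒥.J.exists_isCyclic_pair_le_torsionPoints_succ (by omega) d
  exact ⟨secantQuotient 𝒥.J hP.isAmple G₁ G₂ (Nat.succ_ne_zero d) h₁ h₂,
    C, hC, 𝒥, h3, Θ, hR, hP, G₁, G₂, h₁, h₂, hc₁, hn₁, hc₂, hn₂, hbot, ⟨Iso.refl _⟩⟩

/-- **… and WITH ITS CLASS**: under the same data there are `Y` and `θ_Y` with `IsSecantQuotientAnchorWith d Y.X θ_Y`
(`θ_Y = h_Y(θ₀)` for a polarisation class `θ₀ ∈ ℚˣ·[Θ]`, which exists because `Θ` is ample on an abelian variety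
of positive dimension, `AbelianVariety.IsPrincipalPolarizationDivisor.exists_isPolarizationClassOf`).
[cite: Markman2025SecantWeil, §1.5 (p. 7)] [cite: Lange2023AbelianVarietiesComplex, §2.1.1 (p. 68)] -/
theorem exists_isSecantQuotientAnchorWith {C : SchemeOver ℂ} (hC : IsSmoothProjective 1 C) (𝒥 : Jacobian C)
    (h3 : 𝒥.J.dim = 3) {Θ : CartierDivisor 𝒥.J.X.left} (hR : 𝒥.IsRiemannThetaDivisor Θ)
    (hP : 𝒥.J.IsPrincipalPolarizationDivisor Θ) (d : ℕ) :
    ∃ (Y : AbelianVariety ℂ) (θY : complexBetti Y.X 2), IsSecantQuotientAnchorWith d Y.X θY := by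
  obtain ⟨G₁, G₂, h₁, h₂, hc₁, hn₁, hc₂, hn₂, hbot⟩ :=
    𝒥.J.exists_isCyclic_pair_le_torsionPoints_succ (by omega) d
  obtain ⟨θ₀, hθ₀⟩ := hP.exists_isPolarizationClassOf (by omega)
  exact ⟨secantQuotient 𝒥.J hP.isAmple G₁ G₂ (Nat.succ_ne_zero d) h₁ h₂, _,
    isSecantQuotientAnchorWith_map hC 𝒥 h3 hR hP hθ₀ h₁ h₂ hc₁ hn₁ hc₂ hn₂ hbot (Iso.refl _)⟩

/-- **Modulo Riemann's theorem, every genus-`3` Jacobian yields secant-quotient sixfolds of every level**: under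
the named fact `Jacobian.riemann_brillNoetherLocus_isPrincipalPolarizationDivisor` (`Motives/JacobianThetaDivisor`), for
every smooth projective complex curve `C` and Jacobian `𝒥` with `dim J = 3`, and every `d`,
`∃ Y, IsSecantQuotientSixfold d Y` — the envelope of the ring-2 anchors is inhabited as soon as a genus-`3` curve
is given. [cite: Markman2025SecantWeil, §1.5 (p. 7)] [cite: Lange2023AbelianVarietiesComplex, §4.2.1 Lemma 4.2.1 (iii)] -/
theorem exists_isSecantQuotientSixfold_of_riemann (h : Jacobian.riemann_brillNoetherLocus_isPrincipalPolarizationDivisor)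
    {C : SchemeOver ℂ} (hC : IsSmoothProjective 1 C) (𝒥 : Jacobian C) (h3 : 𝒥.J.dim = 3) (d : ℕ) :
    ∃ Y : AbelianVariety ℂ, IsSecantQuotientSixfold d Y := by
  obtain ⟨Θ, hR, hP⟩ := h C hC 𝒥 (by omega)
  exact exists_isSecantQuotientSixfold hC 𝒥 h3 hR hP d

/-- The same WITH CLASS, modulo Riemann's theorem. [cite: Markman2025SecantWeil, §1.5 (p. 7)]
[cite: Lange2023AbelianVarietiesComplex, §4.2.1 Lemma 4.2.1 (iii) and §2.1.1 (p. 68)] -/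
theorem exists_isSecantQuotientAnchorWith_of_riemann (h : Jacobian.riemann_brillNoetherLocus_isPrincipalPolarizationDivisor)
    {C : SchemeOver ℂ} (hC : IsSmoothProjective 1 C) (𝒥 : Jacobian C) (h3 : 𝒥.J.dim = 3) (d : ℕ) :
    ∃ (Y : AbelianVariety ℂ) (θY : complexBetti Y.X 2), IsSecantQuotientAnchorWith d Y.X θY := by
  obtain ⟨Θ, hR, hP⟩ := h C hC 𝒥 (by omega)
  exact exists_isSecantQuotientAnchorWith hC 𝒥 h3 hR hP d

end Literature.AlgebraicGeometry.Markman2025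

end
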